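/-
Copyright (c) 2026 the pub-hodgecm-mathlib formalisation cell (harness21).  Prover seat hodgecm-mathlib-LH4-p16 (g2), req620 Track A «(D-RAM) FOUR-FRAME» squad
(STAGE-1b, row (2) of the piece `f_{T₊}`, the (β₂) road (R-36); β₂ sub-dealer LH4-p04 (g9) «= ROAD K5∕K6», target ‹CORE.letter.v1›; MECH-K3 v1 §2 «population ⟺ ω(t)»:
K5-C, seventh file), 2026-09-05.
-/
import Summits.HodgeConjecture.HodgeConjecture.Theorems.F0P3cDyRamRowCellFibreTransport   -- ★ p863477 (this seat): `trace_letters`, `dualGen_sub_map_eq`; brings ★ p863246 (`isOrd_*_of_skew`), ★ `dualGen_mul_left`, ★ DEFS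
import HarnessLib

/-!
# Crux `H413`, line LH4 «(D-RAM) FOUR-FRAME» — STAGE-1b, row (2), the (β₂) road (R-36), (ROW-INT) ∕ ‹CORE›, K5-C (7): «THE TWO POPULATION HALVES OF A DIGIT FIBRE ARE
# EQUINUMEROUS» — the flip by a doubly-fixed non-norm unit `c` fixes the digit and swaps the population class

Cell `hodgecm-mathlib` (D-0151), FLOOR 0, crux item H413 = `stmt-HodgeConjecture-24833`, route of record `HCCMUnconditional`; squad F0∕P3c∕LH4; lane
`--supports stmt-HodgeConjecture-24833 --as helper` (count-neutral; pays NO tier-0 row).  THEOREMS ONLY (no `def`, no instance, no notation, no `sorry`, default heartbeats);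
★-only imports; states NO law; (β₂) stays a HYPOTHESIS.  DATUM-FREE one-field letters as in ★ p863477, plus a doubly-fixed unit `c` which is NOT the `Θ`-norm of a `ρ`-fixed
element together with the DICHOTOMY letter `hdichF` («every doubly-fixed unit is `eΘe` or `c·eΘe` with `ρe = e`» — the `E∕F` norm index two; `E`-side ★ Lit
`exists_nonnorm_dichotomy`), and a flip `ε` with `εΘε = c` (exists by frame `_c14`: doubly-fixed units are `Θ`-norms).
WHY (MECH-K3 v1 §2 `F0/P3c/LH4/LH4-p16/g2/MECH-K3.v1.LH4p16g2.md`).  In the coordinates `(t, κ̂)` of a row vertex (`u₀ = h·x₀Θx₀`, `t = Tr_ρ u₀`, `κ̂ = ρu₀∕t`) the POPULATION of the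
glued vertex (its weight `f b j Λ ≠ 0`) is the `E∕F`-norm class of `t` (the glue unit is `∝ t`), the LABEL digit is `κ̂`.  ★ p863477 ∕ ★-cand K5-C (6) make the fibres over the digits
equinumerous at FIXED class; THIS FILE makes the two CLASSES equinumerous at FIXED digit: the flip `Λ ↦ ε • Λ` with `εΘε = c` doubly fixed multiplies `u₀` by `c`, so `t′ = c·t`
(class swapped, `c` a non-norm) and `κ̂′ = κ̂` (digit kept), and keeps every cell clause (skew ZERO: `c − ρc = 0`).  Hence the vertex count of a cell factorises as
«(#digits in the sphere ∩ Q-class) × (uniform fibre) » with the populated half exactly one half — MECH-K3's `ρ₀∕2`.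
* §1 `map_mul_fixed_sub` (`cY − ρ(cY) = c(Y − ρY)`), the class swap `exists_fixed_normTheta_mul_iff_not`;
* §2 HEAD `ncard_fibre_le_ncard_fibre_not` (fibre(P, κ₁) ↪ fibre(¬P, κ₁) under `ε •`) and `ncard_fibre_eq_ncard_fibre_not` (equality, via `P ↦ ¬P` and `ε⁻¹`, `ε⁻¹Θε⁻¹ = c⁻¹`).
WHAT IS NOT CLAIMED: which class is the populated one for which literal (the glue-unit dictionary, ★ `exists_map_eq_glueUnit`), any census identity.
HONEST LABEL.  Count-neutral lattice bookkeeping; nothing printed is asserted; no census law is stated; `HC_CM` is proved only modulo the 7 printed citations (2 remaining named inputs: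
hLiu418 = `stmt-HodgeConjecture-24832`, h413 = `stmt-HodgeConjecture-24833`) until rung 0 closes.
## References
* [Jacobowitz1962] R. Jacobowitz, *Hermitian forms over local fields*, Amer. J. Math. 84 (1962): §4.
* [Kottwitz1986BaseChangeUnits] R. E. Kottwitz, *Base change for unit elements of Hecke algebras*, Compositio Math. 60 (1986): §1 pp. 240–241.
* [Serre1979] J.-P. Serre, *Local Fields*, GTM 67 (1979): Ch. V §3 Cor. 3 (the norm index), Ch. III §6 Prop. 12.
-/

set_option autoImplicit false

noncomputable section

namespace Summit.HodgeConjecture.HodgeConjecture.Cruxes.H413.F0P3cDyRamRowCellPopulationHalves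

open scoped Valued WithZero Pointwise
open WithZero
open Summit.HodgeConjecture.HodgeConjecture.Cruxes.H413.F0P3cDyRamToricCensusDefs
open Summit.HodgeConjecture.HodgeConjecture.Cruxes.H413.F0P3cDyRamConeCellLabelBalance (dualGen_mul_left)
open Summit.HodgeConjecture.HodgeConjecture.Cruxes.H413.F0P3cDyRamRowCellFlipTransport (isOrd_mul_iff_of_skew isOrd_mul_div_iff_of_skew isOrd_div_mul_of_skew)
open Summit.HodgeConjecture.HodgeConjecture.Cruxes.H413.F0P3cDyRamRowCellFibreTransport (dualGen_sub_map_eq trace_letters)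

variable {K : Type} [Field K] [Valued K ℤᵐ⁰] {ρ Θ : K →+* K} {α : K}

/-! ## §1 The class swap -/

omit [Valued K ℤᵐ⁰] in
/-- **THE CLASS SWAP**: `c` doubly fixed and NOT `eΘe` with `ρe = e`, the dichotomy letter ⟹ (`c·t` is such a norm) ⟺ (`t` is not), for a doubly-fixed unit `t` (`|·|`-free form:
the dichotomy is taken at `t ≠ 0`). [cite: Serre1979, Ch. V §3 Cor. 3] -/
theorem exists_fixed_normTheta_mul_iff_not {c t : K} (ht0 : t ≠ 0) (hcn : ¬ ∃ e : K, ρ e = e ∧ e * Θ e = c)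
    (hdich : (∃ e : K, ρ e = e ∧ e * Θ e = t) ∨ ∃ e : K, ρ e = e ∧ e * Θ e = c * t) :
    (∃ e : K, ρ e = e ∧ e * Θ e = c * t) ↔ ¬ ∃ e : K, ρ e = e ∧ e * Θ e = t := by
  refine ⟨fun ⟨e₂, hρe₂, he₂⟩ ⟨e₁, hρe₁, he₁⟩ => hcn ?_, fun h => hdich.resolve_left h⟩
  have he₁0 : e₁ ≠ 0 := fun h0 => by rw [h0, zero_mul] at he₁; exact ht0 he₁.symm
  refine ⟨e₂ / e₁, by rw [map_div₀, hρe₂, hρe₁], ?_⟩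
  rw [map_div₀, div_mul_div_comm, he₂, he₁, mul_div_cancel_right₀ _ ht0]

/-! ## §2 HEADS — the flip by `c` -/

/-- **HEAD — «THE TWO POPULATION HALVES OF A DIGIT FIBRE ARE EQUINUMEROUS» (injection half).**  ★ p863477's fibres over ONE digit `κ₁` with the class predicate `P` resp. `¬P`;
`c` a doubly-fixed unit, not a `ρ`-fixed `Θ`-norm, with the dichotomy letter `hdichF`; `εΘε = c` ⟹ `Λ ↦ ε • Λ` injects fibre(P, κ₁) into fibre(¬P, κ₁): the generator `ε·x₀`
has `u₀′ = c·u₀`, `t′ = c·t`, `κ̂′ = κ̂`, and the cell clauses are kept (skew zero). [cite: Kottwitz1986BaseChangeUnits, §1 pp. 240–241] [cite: Jacobowitz1962, §4] [cite: Serre1979, Ch. V §3 Cor. 3] -/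
theorem ncard_fibre_le_ncard_fibre_not (hρρ : ∀ x, ρ (ρ x) = x) (hvρ : ∀ x, Valued.v (ρ x) = Valued.v x) (hΘΘ : ∀ x, Θ (Θ x) = x)
    (hΘρ : ∀ x, Θ (ρ x) = ρ (Θ x))
    {h ϖE μ : K} (hΘh : Θ h = h) (hρϖ : ρ ϖE = ϖE) (hϖ0 : ϖE ≠ 0) (hϖ1 : Valued.v ϖE ≤ 1) {j a : ℕ} (ha1 : 1 ≤ a)
    (hcc : ϖE ^ j * (α - ρ α) ≠ 0)
    (hμ : Valued.v μ ≤ (Valued.v ϖE ^ a) ^ 2)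
    (hFgap : ∀ z : K, ρ z = z → Θ z = z → Valued.v ϖE < Valued.v z → Valued.v z ≤ 1 → Valued.v z = 1)
    {c : K} (hρc : ρ c = c) (hc1 : Valued.v c = 1) (hcn : ¬ ∃ e : K, ρ e = e ∧ e * Θ e = c)
    (hdichF : ∀ u : K, ρ u = u → Θ u = u → Valued.v u = 1 → (∃ e : K, ρ e = e ∧ e * Θ e = u) ∨ ∃ e : K, ρ e = e ∧ e * Θ e = c * u)
    {ε : K} (hε : ε * Θ ε = c) (κ₁ : K) (r : ℤᵐ⁰) (P : Prop) (hfin : (levelSet ρ Θ α ϖE h j a).Finite) :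
    {Λ : AddSubgroup K | ∃ x₀ : K, x₀ ≠ 0 ∧ (∀ x, x ∈ Λ ↔ ∃ ζ, IsOrd ρ α (ϖE ^ j) ζ ∧ x = x₀ * ζ) ∧
        IsOrd ρ α (ϖE ^ j) (dualGen ρ Θ α (ϖE ^ j) h x₀) ∧ ¬ IsOrd ρ α (ϖE ^ j) (dualGen ρ Θ α (ϖE ^ j) h x₀ / ϖE) ∧
        Valued.v (dualGen ρ Θ α (ϖE ^ j) h x₀) = Valued.v ϖE ^ a ∧ IsOrd ρ α (ϖE ^ j) (μ / dualGen ρ Θ α (ϖE ^ j) h x₀) ∧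
        ((∃ c : K, ρ c = c ∧ c * Θ c = h * (x₀ * Θ x₀) + ρ (h * (x₀ * Θ x₀))) ↔ P) ∧
        Valued.v (ρ (h * (x₀ * Θ x₀)) / (h * (x₀ * Θ x₀) + ρ (h * (x₀ * Θ x₀))) - κ₁) ≤ r}.ncard ≤
      {Λ : AddSubgroup K | ∃ x₀ : K, x₀ ≠ 0 ∧ (∀ x, x ∈ Λ ↔ ∃ ζ, IsOrd ρ α (ϖE ^ j) ζ ∧ x = x₀ * ζ) ∧
        IsOrd ρ α (ϖE ^ j) (dualGen ρ Θ α (ϖE ^ j) h x₀) ∧ ¬ IsOrd ρ α (ϖE ^ j) (dualGen ρ Θ α (ϖE ^ j) h x₀ / ϖE) ∧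
        Valued.v (dualGen ρ Θ α (ϖE ^ j) h x₀) = Valued.v ϖE ^ a ∧ IsOrd ρ α (ϖE ^ j) (μ / dualGen ρ Θ α (ϖE ^ j) h x₀) ∧
        ((∃ c : K, ρ c = c ∧ c * Θ c = h * (x₀ * Θ x₀) + ρ (h * (x₀ * Θ x₀))) ↔ ¬ P) ∧
        Valued.v (ρ (h * (x₀ * Θ x₀)) / (h * (x₀ * Θ x₀) + ρ (h * (x₀ * Θ x₀))) - κ₁) ≤ r}.ncard := by
  classical
  have hc0 : c ≠ 0 := fun h0 => by rw [h0, map_zero] at hc1; exact zero_ne_one hc1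
  have hN1 : Valued.v (ε * Θ ε) = 1 := by rw [hε, hc1]
  have hε0 : ε ≠ 0 := fun h0 => by rw [h0, zero_mul, map_zero] at hN1; exact zero_ne_one hN1
  have hρcc : ρ (ϖE ^ j) = ϖE ^ j := by rw [map_pow, hρϖ]
  have hccpos : (0 : ℤᵐ⁰) < Valued.v (ϖE ^ j * (α - ρ α)) := zero_lt_iff.2 ((Valuation.ne_zero_iff _).2 hcc)
  refine Set.ncard_le_ncard_of_injOn (fun Λ => ε • Λ) (fun Λ hΛ => ?_) (fun Λ₁ _ Λ₂ _ h12' => by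
      have := congrArg (fun Λ => ε⁻¹ • Λ) h12'
      simpa only [smul_smul, inv_mul_cancel₀ hε0, one_smul] using this)
    (hfin.subset fun Λ ⟨x₀, hx₀, hmem, hyO, hyprim, hylev, _, _, _⟩ => ⟨x₀, hx₀, hmem, hyO, hyprim, hylev⟩)
  obtain ⟨x₀, hx₀, hmem, hyO, hyprim, hylev, hdep, hcls, hdig⟩ := hΛ
  obtain ⟨hρt, hΘt, ht1⟩ := trace_letters (α := α) hρρ hΘΘ hΘρ hΘh hρϖ hϖ0 hϖ1 ha1 hcc hFgap hyO hyprim hylev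
  set u₀ : K := h * (x₀ * Θ x₀) with hu₀def
  set t : K := u₀ + ρ u₀ with htdef
  have ht0 : t ≠ 0 := fun h0 => by rw [h0, map_zero] at ht1; exact zero_ne_one ht1
  -- skew zero: the cell clauses transfer
  have hYsk : Valued.v (dualGen ρ Θ α (ϖE ^ j) h x₀ - ρ (dualGen ρ Θ α (ϖE ^ j) h x₀)) = Valued.v (ϖE ^ j * (α - ρ α)) := by
    rw [dualGen_sub_map_eq (Θ := Θ) (α := α) hρρ hρcc, Valuation.map_mul, ht1, one_mul]
  have hsk : Valued.v (ε * Θ ε - ρ (ε * Θ ε)) * Valued.v (dualGen ρ Θ α (ϖE ^ j) h x₀) <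
      Valued.v (dualGen ρ Θ α (ϖE ^ j) h x₀ - ρ (dualGen ρ Θ α (ϖE ^ j) h x₀)) := by
    rw [hε, hρc, sub_self, Valuation.map_zero, zero_mul, hYsk]; exact hccpos
  have hdg : dualGen ρ Θ α (ϖE ^ j) h (ε * x₀) = (ε * Θ ε) * dualGen ρ Θ α (ϖE ^ j) h x₀ := dualGen_mul_left _ _ _ _
  -- the new `u₀′ = c·u₀`, `t′ = c·t`, `κ̂′ = κ̂`
  have hu' : h * (ε * x₀ * Θ (ε * x₀)) = c * u₀ := by rw [← hε, hu₀def, map_mul]; ring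
  have ht' : h * (ε * x₀ * Θ (ε * x₀)) + ρ (h * (ε * x₀ * Θ (ε * x₀))) = c * t := by rw [hu', map_mul, hρc, htdef]; ring
  have hκ' : ρ (h * (ε * x₀ * Θ (ε * x₀))) / (h * (ε * x₀ * Θ (ε * x₀)) + ρ (h * (ε * x₀ * Θ (ε * x₀)))) = ρ u₀ / t := by
    rw [ht', hu', map_mul, hρc, mul_div_mul_left _ _ hc0]
  refine ⟨ε * x₀, mul_ne_zero hε0 hx₀, fun x => ?_, ?_, ?_, ?_, ?_, ?_, ?_⟩
  · rw [AddSubgroup.mem_smul_pointwise_iff_exists]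
    constructor
    · rintro ⟨s, hs, rfl⟩
      obtain ⟨z, hz, rfl⟩ := (hmem s).1 hs
      exact ⟨z, hz, by rw [smul_eq_mul, mul_assoc]⟩
    · rintro ⟨z, hz, rfl⟩
      exact ⟨x₀ * z, (hmem _).2 ⟨z, hz, rfl⟩, by rw [smul_eq_mul, mul_assoc]⟩
  · rw [hdg]; exact (isOrd_mul_iff_of_skew hvρ hN1 hsk _).2 hyO
  · rw [hdg, mul_div_assoc]
    intro h'
    rw [← mul_div_assoc] at h'
    exact hyprim ((isOrd_mul_div_iff_of_skew hvρ hN1 hsk hρϖ _).1 h')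
  · rw [hdg, Valuation.map_mul, hN1, one_mul, hylev]
  · rw [hdg]
    exact isOrd_div_mul_of_skew hvρ hN1 hsk hyO (by rw [hylev]; exact hμ) hdep
  · -- the class of `t′ = c·t` is the opposite class
    rw [ht', ← hcls]
    exact exists_fixed_normTheta_mul_iff_not ht0 hcn (hdichF t hρt hΘt ht1)
  · rw [hκ']; exact hdig

/-- **HEAD′ — equality.**  Applying the injection to `¬P` with `ε⁻¹` (`ε⁻¹Θε⁻¹ = c⁻¹`, again doubly fixed, a unit, not a norm, with the dichotomy transported) gives the reverse
inequality (`¬¬P ↔ P`), so `#fibre(P, κ₁) = #fibre(¬P, κ₁)`: exactly ONE HALF of every digit fibre is populated for each literal. [cite: Kottwitz1986BaseChangeUnits, §1 pp. 240–241]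
[cite: Serre1979, Ch. V §3 Cor. 3] -/
theorem ncard_fibre_eq_ncard_fibre_not (hρρ : ∀ x, ρ (ρ x) = x) (hvρ : ∀ x, Valued.v (ρ x) = Valued.v x) (hΘΘ : ∀ x, Θ (Θ x) = x)
    (hΘρ : ∀ x, Θ (ρ x) = ρ (Θ x))
    {h ϖE μ : K} (hΘh : Θ h = h) (hρϖ : ρ ϖE = ϖE) (hϖ0 : ϖE ≠ 0) (hϖ1 : Valued.v ϖE ≤ 1) {j a : ℕ} (ha1 : 1 ≤ a)
    (hcc : ϖE ^ j * (α - ρ α) ≠ 0)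
    (hμ : Valued.v μ ≤ (Valued.v ϖE ^ a) ^ 2)
    (hFgap : ∀ z : K, ρ z = z → Θ z = z → Valued.v ϖE < Valued.v z → Valued.v z ≤ 1 → Valued.v z = 1)
    {c : K} (hρc : ρ c = c) (hΘc : Θ c = c) (hc1 : Valued.v c = 1) (hcn : ¬ ∃ e : K, ρ e = e ∧ e * Θ e = c)
    (hdichF : ∀ u : K, ρ u = u → Θ u = u → Valued.v u = 1 → (∃ e : K, ρ e = e ∧ e * Θ e = u) ∨ ∃ e : K, ρ e = e ∧ e * Θ e = c * u)
    {ε : K} (hε : ε * Θ ε = c) (κ₁ : K) (r : ℤᵐ⁰) (P : Prop) (hfin : (levelSet ρ Θ α ϖE h j a).Finite) :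
    {Λ : AddSubgroup K | ∃ x₀ : K, x₀ ≠ 0 ∧ (∀ x, x ∈ Λ ↔ ∃ ζ, IsOrd ρ α (ϖE ^ j) ζ ∧ x = x₀ * ζ) ∧
        IsOrd ρ α (ϖE ^ j) (dualGen ρ Θ α (ϖE ^ j) h x₀) ∧ ¬ IsOrd ρ α (ϖE ^ j) (dualGen ρ Θ α (ϖE ^ j) h x₀ / ϖE) ∧
        Valued.v (dualGen ρ Θ α (ϖE ^ j) h x₀) = Valued.v ϖE ^ a ∧ IsOrd ρ α (ϖE ^ j) (μ / dualGen ρ Θ α (ϖE ^ j) h x₀) ∧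
        ((∃ c : K, ρ c = c ∧ c * Θ c = h * (x₀ * Θ x₀) + ρ (h * (x₀ * Θ x₀))) ↔ P) ∧
        Valued.v (ρ (h * (x₀ * Θ x₀)) / (h * (x₀ * Θ x₀) + ρ (h * (x₀ * Θ x₀))) - κ₁) ≤ r}.ncard =
      {Λ : AddSubgroup K | ∃ x₀ : K, x₀ ≠ 0 ∧ (∀ x, x ∈ Λ ↔ ∃ ζ, IsOrd ρ α (ϖE ^ j) ζ ∧ x = x₀ * ζ) ∧
        IsOrd ρ α (ϖE ^ j) (dualGen ρ Θ α (ϖE ^ j) h x₀) ∧ ¬ IsOrd ρ α (ϖE ^ j) (dualGen ρ Θ α (ϖE ^ j) h x₀ / ϖE) ∧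
        Valued.v (dualGen ρ Θ α (ϖE ^ j) h x₀) = Valued.v ϖE ^ a ∧ IsOrd ρ α (ϖE ^ j) (μ / dualGen ρ Θ α (ϖE ^ j) h x₀) ∧
        ((∃ c : K, ρ c = c ∧ c * Θ c = h * (x₀ * Θ x₀) + ρ (h * (x₀ * Θ x₀))) ↔ ¬ P) ∧
        Valued.v (ρ (h * (x₀ * Θ x₀)) / (h * (x₀ * Θ x₀) + ρ (h * (x₀ * Θ x₀))) - κ₁) ≤ r}.ncard := by
  have hc0 : c ≠ 0 := fun h0 => by rw [h0, map_zero] at hc1; exact zero_ne_one hc1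
  refine le_antisymm (ncard_fibre_le_ncard_fibre_not hρρ hvρ hΘΘ hΘρ hΘh hρϖ hϖ0 hϖ1 ha1 hcc hμ hFgap hρc hc1 hcn hdichF hε κ₁ r P hfin) ?_
  -- the reverse injection: flip by `ε⁻¹`, `ε⁻¹Θε⁻¹ = c⁻¹`
  have hcinv : ¬ ∃ e : K, ρ e = e ∧ e * Θ e = c⁻¹ := fun ⟨e, hρe, he⟩ =>
    hcn ⟨e⁻¹, by rw [map_inv₀, hρe], by rw [map_inv₀, ← mul_inv, he, inv_inv]⟩
  have hdich' : ∀ u : K, ρ u = u → Θ u = u → Valued.v u = 1 → (∃ e : K, ρ e = e ∧ e * Θ e = u) ∨ ∃ e : K, ρ e = e ∧ e * Θ e = c⁻¹ * u := by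
    intro u hρu hΘu hu1
    rcases hdichF (c⁻¹ * u) (by rw [map_mul, map_inv₀, hρc, hρu]) (by rw [map_mul, map_inv₀, hΘc, hΘu])
        (by rw [Valuation.map_mul, map_inv₀, hc1, inv_one, one_mul, hu1]) with h1 | ⟨e, hρe, he⟩
    · exact Or.inr h1
    · exact Or.inl ⟨e, hρe, by rw [he, mul_inv_cancel_left₀ hc0]⟩
  have h' := ncard_fibre_le_ncard_fibre_not hρρ hvρ hΘΘ hΘρ hΘh hρϖ hϖ0 hϖ1 ha1 hcc hμ hFgap
    (by rw [map_inv₀, hρc]) (by rw [map_inv₀, hc1, inv_one]) hcinv hdich'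
    (ε := ε⁻¹) (by rw [map_inv₀, ← mul_inv, hε]) κ₁ r (¬ P) hfin
  simp only [not_not] at h'
  exact h'

end Summit.HodgeConjecture.HodgeConjecture.Cruxes.H413.F0P3cDyRamRowCellPopulationHalves

end
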